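import Mathlib.Analysis.SpecialFunctions.Gamma.Basic
import Mathlib.Analysis.SpecialFunctions.Gaussian.GaussianIntegral
import HarnessLib

/-!
# Laplace integrals with an algebraic endpoint singularity: `∫_0^ℓ u^{−μ} e^{−Lu} q(u) du`

Topic `Literature/Analysis/Asymptotics` (Watson's lemma, leading term, at an endpoint of algebraic
type). Everything here is PROVED; no definitions, no named facts.

For `μ < 1`, `L > 0` and an amplitude `q` with `‖q(u) − q₀‖ ≤ M u` on `(0, ℓ]`,

  `∫_0^ℓ u^{−μ} e^{−Lu} q(u) du = q₀ Γ(1−μ) L^{μ−1} + O(M Γ(2−μ) L^{μ−2}) + O(‖q₀‖ Γ(1−μ)(L/2)^{μ−1} e^{−ℓL/2})`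

with implied constants `1` (`norm_setIntegral_rpowExpWeight_mul_sub_le`). This is the real-variable
core of the **Hankel loop integral** of the Selberg–Delange method: after collapsing a loop around a
branch cut `[1 − ℓ, 1]` of `(s − 1)^{−μ} h(s) x^{s}` onto the cut one is left with
`2i sin(πμ) x ∫_0^ℓ u^{−μ} x^{−u} h(1 − u) du`, i.e. the above with `L = log x`, and
`sin(πμ) Γ(1−μ)/π = 1/Γ(μ)` recovers the familiar main term `x (log x)^{μ−1} h(1)/Γ(μ)`
(Tenenbaum, *Introduction to analytic and probabilistic number theory*, II.5, Thm. 5.2 and its proof,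
Hankel's formula II.0 Thm. 0.17; Montgomery 1983, §4, the evaluation
`∫_C z^{−b̂(1)} N^z dz = 2iΓ(1 − b̂(1)) sin(π b̂(1)) (log N)^{b̂(1)−1}` between (23) and (24)).
Only `μ < 1` is needed (the loop around the branch point then carries no mass), which is the case
`|b̂(k)| < 1` of Montgomery's paper and of the barrier `Montgomery1983_theorem`
(`Literature/Barriers/RiemannHypothesis/TuranPartialSums.lean`).

## Main results

* `integral_rpowExpWeight` — `∫_0^∞ u^{−μ} e^{−Lu} du = Γ(1−μ) L^{μ−1}` (`μ < 1`, `L > 0`);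
* `setIntegral_Ioi_rpowExpWeight_le` — the tail `∫_ℓ^∞ u^{−μ} e^{−Lu} du ≤ e^{−ℓL/2} Γ(1−μ) (L/2)^{μ−1}`;
* `norm_setIntegral_rpowExpWeight_mul_le` — `‖∫_0^ℓ u^{−μ} e^{−Lu} q‖ ≤ B Γ(1−μ) L^{μ−1}` for `‖q‖ ≤ B`;
* `norm_setIntegral_rpowExpWeight_mul_sub_le` — the leading-term asymptotic displayed above.

## References

* G. Tenenbaum, *Introduction to analytic and probabilistic number theory*, 3rd ed., AMS GSM 163
  (2015), II.0 Thm. 0.17 (Hankel's formula), II.5 §5.1 Thm. 5.2 (Selberg–Delange, the loop integral).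
* H. L. Montgomery, *Zeros of approximations to the zeta function*, Studies in Pure Mathematics
  (Birkhäuser 1983), 497–506, §4 ((23)–(24)).
* G. N. Watson, *The harmonic functions associated with the parabolic cylinder*, Proc. LMS 17 (1918)
  (Watson's lemma); folklore.
-/

noncomputable section

open MeasureTheory Set Real

namespace Literature.Analysis.Asymptotics

/-! ### The weight `u^{−μ} e^{−Lu}` -/

/-- The Laplace–Hankel weight `u ↦ u^{−μ} e^{−Lu}` is integrable on `(0, ∞)` for `μ < 1`, `L > 0`.
[folklore] -/
theorem integrableOn_rpowExpWeight {μ L : ℝ} (hμ : μ < 1) (hL : 0 < L) :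
    IntegrableOn (fun u : ℝ ↦ u ^ (-μ) * Real.exp (-(L * u))) (Ioi 0) := by
  have h := integrableOn_rpow_mul_exp_neg_mul_rpow (s := -μ) (p := 1) (b := L)
    (by linarith) le_rfl hL
  refine h.congr_fun (fun u _ ↦ ?_) measurableSet_Ioi
  simp only [Real.rpow_one, neg_mul]

/-- **`∫_0^∞ u^{−μ} e^{−Lu} du = Γ(1 − μ) L^{μ−1}`** for `μ < 1`, `L > 0` (Euler's integral).
[folklore] -/
theorem integral_rpowExpWeight {μ L : ℝ} (hμ : μ < 1) (hL : 0 < L) :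
    ∫ u in Ioi 0, u ^ (-μ) * Real.exp (-(L * u)) = Real.Gamma (1 - μ) * L ^ (μ - 1) := by
  have h := Real.integral_rpow_mul_exp_neg_mul_Ioi (a := 1 - μ) (r := L) (by linarith) hL
  have e1 : (1 - μ - 1 : ℝ) = -μ := by ring
  rw [e1] at h
  rw [h, one_div, Real.inv_rpow hL.le, ← Real.rpow_neg hL.le, neg_sub, mul_comm]

/-- The weight is nonnegative on `(0, ∞)`. [folklore] -/
theorem rpowExpWeight_nonneg (μ L : ℝ) {u : ℝ} (hu : 0 ≤ u) :
    0 ≤ u ^ (-μ) * Real.exp (-(L * u)) :=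
  mul_nonneg (Real.rpow_nonneg hu _) (Real.exp_pos _).le

/-- **Tail bound**: `∫_ℓ^∞ u^{−μ} e^{−Lu} du ≤ e^{−ℓL/2} Γ(1 − μ) (L/2)^{μ−1}` (`μ < 1`, `L, ℓ > 0`;
from `e^{−Lu} ≤ e^{−ℓL/2} e^{−Lu/2}` for `u ≥ ℓ`). [folklore] -/
theorem setIntegral_Ioi_rpowExpWeight_le {μ L ℓ : ℝ} (hμ : μ < 1) (hL : 0 < L) (hℓ : 0 < ℓ) :
    ∫ u in Ioi ℓ, u ^ (-μ) * Real.exp (-(L * u)) ≤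
      Real.exp (-(ℓ * L / 2)) * (Real.Gamma (1 - μ) * (L / 2) ^ (μ - 1)) := by
  have hL2 : 0 < L / 2 := by positivity
  have hint2 := integrableOn_rpowExpWeight hμ hL2
  have hint := integrableOn_rpowExpWeight hμ hL
  calc ∫ u in Ioi ℓ, u ^ (-μ) * Real.exp (-(L * u))
      ≤ ∫ u in Ioi ℓ, Real.exp (-(ℓ * L / 2)) * (u ^ (-μ) * Real.exp (-(L / 2 * u))) := by
        refine setIntegral_mono_on (hint.mono_set (Ioi_subset_Ioi hℓ.le))
          ((hint2.mono_set (Ioi_subset_Ioi hℓ.le)).const_mul _) measurableSet_Ioi fun u hu ↦ ?_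
        have hu : ℓ < u := hu
        have hu0 : 0 ≤ u := (hℓ.trans hu).le
        rw [mul_left_comm]
        refine mul_le_mul_of_nonneg_left ?_ (Real.rpow_nonneg hu0 _)
        rw [← Real.exp_add]
        exact Real.exp_le_exp.2 (by nlinarith)
    _ ≤ ∫ u in Ioi 0, Real.exp (-(ℓ * L / 2)) * (u ^ (-μ) * Real.exp (-(L / 2 * u))) := by
        refine setIntegral_mono_set (hint2.const_mul _) ?_ (Ioi_subset_Ioi hℓ.le).eventuallyLE
        filter_upwards [ae_restrict_mem measurableSet_Ioi] with u hu
        exact mul_nonneg (Real.exp_pos _).le (rpowExpWeight_nonneg μ (L / 2) (le_of_lt hu))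
    _ = Real.exp (-(ℓ * L / 2)) * (Real.Gamma (1 - μ) * (L / 2) ^ (μ - 1)) := by
        rw [integral_const_mul, integral_rpowExpWeight hμ hL2]

/-- `∫_0^ℓ u^{−μ} e^{−Lu} du ≤ Γ(1 − μ) L^{μ−1}`. [folklore] -/
theorem setIntegral_Ioc_rpowExpWeight_le {μ L ℓ : ℝ} (hμ : μ < 1) (hL : 0 < L) :
    ∫ u in Ioc 0 ℓ, u ^ (-μ) * Real.exp (-(L * u)) ≤ Real.Gamma (1 - μ) * L ^ (μ - 1) := by
  rw [← integral_rpowExpWeight hμ hL]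
  refine setIntegral_mono_set (integrableOn_rpowExpWeight hμ hL) ?_ Ioc_subset_Ioi_self.eventuallyLE
  filter_upwards [ae_restrict_mem measurableSet_Ioi] with u hu
  exact rpowExpWeight_nonneg μ L (le_of_lt hu)

/-- The first-moment weight: `∫_0^ℓ u · u^{−μ} e^{−Lu} du ≤ Γ(2 − μ) L^{μ−2}`. [folklore] -/
theorem setIntegral_Ioc_mul_rpowExpWeight_le {μ L ℓ : ℝ} (hμ : μ < 1) (hL : 0 < L) :
    ∫ u in Ioc 0 ℓ, u * (u ^ (-μ) * Real.exp (-(L * u))) ≤ Real.Gamma (2 - μ) * L ^ (μ - 2) := by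
  have hμ' : μ - 1 < 1 := by linarith
  have h1 := setIntegral_Ioc_rpowExpWeight_le (ℓ := ℓ) hμ' hL
  have e1 : (1 - (μ - 1) : ℝ) = 2 - μ := by ring
  have e2 : (μ - 1 - 1 : ℝ) = μ - 2 := by ring
  rw [e1, e2] at h1
  refine le_trans (le_of_eq (setIntegral_congr_fun measurableSet_Ioc fun u hu ↦ ?_)) h1
  have hu : 0 < u := hu.1
  show u * (u ^ (-μ) * Real.exp (-(L * u))) = u ^ (-(μ - 1)) * Real.exp (-(L * u))
  rw [← mul_assoc, neg_sub, Real.rpow_sub hu, Real.rpow_one, Real.rpow_neg hu.le,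
    div_eq_mul_inv]

/-! ### Laplace integrals against an amplitude -/

variable {q : ℝ → ℂ}

/-- Integrability of `u^{−μ} e^{−Lu} q(u)` on `(0, ℓ]` for a measurable amplitude bounded there.
[folklore] -/
theorem integrableOn_rpowExpWeight_mul {μ L ℓ B : ℝ} (hμ : μ < 1) (hL : 0 < L)
    (hq : AEStronglyMeasurable q (volume.restrict (Ioc 0 ℓ)))
    (hB : ∀ u ∈ Ioc 0 ℓ, ‖q u‖ ≤ B) :
    IntegrableOn (fun u : ℝ ↦ ((u ^ (-μ) * Real.exp (-(L * u)) : ℝ) : ℂ) * q u) (Ioc 0 ℓ) := by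
  have hw : IntegrableOn (fun u : ℝ ↦ u ^ (-μ) * Real.exp (-(L * u))) (Ioc 0 ℓ) :=
    (integrableOn_rpowExpWeight hμ hL).mono_set Ioc_subset_Ioi_self
  refine (hw.mul_const B).mono' (hw.ofReal.aestronglyMeasurable.mul hq) ?_
  filter_upwards [ae_restrict_mem measurableSet_Ioc] with u hu
  rw [norm_mul, Complex.norm_real, Real.norm_eq_abs,
    abs_of_nonneg (rpowExpWeight_nonneg μ L hu.1.le)]
  exact mul_le_mul_of_nonneg_left (hB u hu) (rpowExpWeight_nonneg μ L hu.1.le)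

/-- **Crude bound**: `‖∫_0^ℓ u^{−μ} e^{−Lu} q(u) du‖ ≤ B Γ(1 − μ) L^{μ−1}` whenever `‖q‖ ≤ B` on
`(0, ℓ]` (`ℓ > 0`). [folklore] -/
theorem norm_setIntegral_rpowExpWeight_mul_le {μ L ℓ B : ℝ} (hμ : μ < 1) (hL : 0 < L) (hℓ : 0 < ℓ)
    (hB : ∀ u ∈ Ioc 0 ℓ, ‖q u‖ ≤ B) :
    ‖∫ u in Ioc 0 ℓ, ((u ^ (-μ) * Real.exp (-(L * u)) : ℝ) : ℂ) * q u‖ ≤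
      B * (Real.Gamma (1 - μ) * L ^ (μ - 1)) := by
  have hw : IntegrableOn (fun u : ℝ ↦ u ^ (-μ) * Real.exp (-(L * u))) (Ioc 0 ℓ) :=
    (integrableOn_rpowExpWeight hμ hL).mono_set Ioc_subset_Ioi_self
  have hB0 : 0 ≤ B := (norm_nonneg _).trans (hB ℓ ⟨hℓ, le_rfl⟩)
  calc ‖∫ u in Ioc 0 ℓ, ((u ^ (-μ) * Real.exp (-(L * u)) : ℝ) : ℂ) * q u‖
      ≤ ∫ u in Ioc 0 ℓ, B * (u ^ (-μ) * Real.exp (-(L * u))) := by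
        refine norm_integral_le_of_norm_le (hw.const_mul B) ?_
        filter_upwards [ae_restrict_mem measurableSet_Ioc] with u hu
        rw [norm_mul, Complex.norm_real, Real.norm_eq_abs,
          abs_of_nonneg (rpowExpWeight_nonneg μ L hu.1.le), mul_comm]
        exact mul_le_mul_of_nonneg_right (hB u hu) (rpowExpWeight_nonneg μ L hu.1.le)
    _ = B * ∫ u in Ioc 0 ℓ, u ^ (-μ) * Real.exp (-(L * u)) := integral_const_mul _ _
    _ ≤ B * (Real.Gamma (1 - μ) * L ^ (μ - 1)) :=
        mul_le_mul_of_nonneg_left (setIntegral_Ioc_rpowExpWeight_le hμ hL) hB0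

/-- **Leading term of a Laplace integral at an algebraic endpoint** (Watson's lemma, first term;
the cut integral of the Hankel loop in the Selberg–Delange method). Let `μ < 1`, `L > 0`, `ℓ > 0`,
and let `q : ℝ → ℂ` be measurable on `(0, ℓ]` with `‖q(u) − q₀‖ ≤ M u` there. Then
`‖∫_0^ℓ u^{−μ} e^{−Lu} q(u) du − q₀ Γ(1−μ) L^{μ−1}‖ ≤ M Γ(2−μ) L^{μ−2} + ‖q₀‖ e^{−ℓL/2} Γ(1−μ) (L/2)^{μ−1}`.
[cite: Tenenbaum2015, II.5 Thm. 5.2 (proof: the loop integral)] -/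
theorem norm_setIntegral_rpowExpWeight_mul_sub_le {μ L ℓ M : ℝ} (hμ : μ < 1) (hL : 0 < L)
    (hℓ : 0 < ℓ) (hM : 0 ≤ M) (hq : AEStronglyMeasurable q (volume.restrict (Ioc 0 ℓ)))
    {q₀ : ℂ} (hq₀ : ∀ u ∈ Ioc 0 ℓ, ‖q u - q₀‖ ≤ M * u) :
    ‖(∫ u in Ioc 0 ℓ, ((u ^ (-μ) * Real.exp (-(L * u)) : ℝ) : ℂ) * q u) -
        q₀ * ((Real.Gamma (1 - μ) * L ^ (μ - 1) : ℝ) : ℂ)‖ ≤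
      M * (Real.Gamma (2 - μ) * L ^ (μ - 2)) +
        ‖q₀‖ * (Real.exp (-(ℓ * L / 2)) * (Real.Gamma (1 - μ) * (L / 2) ^ (μ - 1))) := by
  -- notation
  set w : ℝ → ℝ := fun u ↦ u ^ (-μ) * Real.exp (-(L * u)) with hw_def
  have hwI : IntegrableOn w (Ioi 0) := integrableOn_rpowExpWeight hμ hL
  have hwIoc : IntegrableOn w (Ioc 0 ℓ) := hwI.mono_set Ioc_subset_Ioi_self
  have hwIoi : IntegrableOn w (Ioi ℓ) := hwI.mono_set (Ioi_subset_Ioi hℓ.le)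
  have hw0 : ∀ u ∈ Ioc (0 : ℝ) ℓ, 0 ≤ w u := fun u hu ↦ rpowExpWeight_nonneg μ L hu.1.le
  -- a bound for `q` on `(0, ℓ]`
  have hqB : ∀ u ∈ Ioc 0 ℓ, ‖q u‖ ≤ ‖q₀‖ + M * ℓ := by
    intro u hu
    have h1 : ‖q u‖ ≤ ‖q u - q₀‖ + ‖q₀‖ := norm_le_norm_sub_add _ _
    have h2 : M * u ≤ M * ℓ := mul_le_mul_of_nonneg_left hu.2 hM
    linarith [hq₀ u hu]
  have hWq : IntegrableOn (fun u : ℝ ↦ ((w u : ℝ) : ℂ) * q u) (Ioc 0 ℓ) :=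
    integrableOn_rpowExpWeight_mul hμ hL hq hqB
  have hWc : IntegrableOn (fun u : ℝ ↦ ((w u : ℝ) : ℂ) * q₀) (Ioc 0 ℓ) := hwIoc.ofReal.mul_const _
  -- split `q = (q − q₀) + q₀`
  have hsplit : (∫ u in Ioc 0 ℓ, ((w u : ℝ) : ℂ) * q u) =
      (∫ u in Ioc 0 ℓ, ((w u : ℝ) : ℂ) * (q u - q₀)) + q₀ * ((∫ u in Ioc 0 ℓ, w u : ℝ) : ℂ) := by
    have hWd : IntegrableOn (fun u : ℝ ↦ ((w u : ℝ) : ℂ) * (q u - q₀)) (Ioc 0 ℓ) :=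
      (hWq.sub hWc).congr (ae_of_all _ fun u ↦ by simp only [Pi.sub_apply]; ring)
    have h1 : (∫ u in Ioc 0 ℓ, ((w u : ℝ) : ℂ) * q u) =
        (∫ u in Ioc 0 ℓ, ((w u : ℝ) : ℂ) * (q u - q₀)) + ∫ u in Ioc 0 ℓ, ((w u : ℝ) : ℂ) * q₀ := by
      rw [← integral_add hWd hWc]
      exact integral_congr_ae (ae_of_all _ fun u ↦ by ring)
    rw [h1, integral_mul_const, integral_complex_ofReal]
    ring
  -- `∫_0^ℓ w = ∫_0^∞ w − ∫_ℓ^∞ w`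
  have hIoc : (∫ u in Ioc 0 ℓ, w u) = (∫ u in Ioi 0, w u) - ∫ u in Ioi ℓ, w u := by
    rw [← Ioc_union_Ioi_eq_Ioi hℓ.le,
      setIntegral_union (Ioc_disjoint_Ioi (le_refl ℓ)) measurableSet_Ioi hwIoc hwIoi]
    ring
  rw [integral_rpowExpWeight hμ hL] at hIoc
  -- the difference
  have hdiff : (∫ u in Ioc 0 ℓ, ((w u : ℝ) : ℂ) * q u) -
      q₀ * ((Real.Gamma (1 - μ) * L ^ (μ - 1) : ℝ) : ℂ) =
      (∫ u in Ioc 0 ℓ, ((w u : ℝ) : ℂ) * (q u - q₀)) - q₀ * ((∫ u in Ioi ℓ, w u : ℝ) : ℂ) := by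
    rw [hsplit, hIoc]; push_cast; ring
  rw [hdiff]
  refine (norm_sub_le _ _).trans (add_le_add ?_ ?_)
  · -- the Lipschitz part
    have hw1 : IntegrableOn (fun u : ℝ ↦ u * w u) (Ioc 0 ℓ) := by
      have h := (integrableOn_rpowExpWeight (μ := μ - 1) (by linarith) hL).mono_set
        (Ioc_subset_Ioi_self : Ioc (0 : ℝ) ℓ ⊆ Ioi 0)
      refine h.congr_fun (fun u hu ↦ ?_) measurableSet_Ioc
      have hu : 0 < u := hu.1
      show u ^ (-(μ - 1)) * Real.exp (-(L * u)) = u * (u ^ (-μ) * Real.exp (-(L * u)))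
      rw [show -(μ - 1) = 1 + -μ by ring, Real.rpow_add hu, Real.rpow_one, mul_assoc]
    calc ‖∫ u in Ioc 0 ℓ, ((w u : ℝ) : ℂ) * (q u - q₀)‖
        ≤ ∫ u in Ioc 0 ℓ, M * (u * w u) := by
          refine norm_integral_le_of_norm_le (hw1.const_mul M) ?_
          filter_upwards [ae_restrict_mem measurableSet_Ioc] with u hu
          rw [norm_mul, Complex.norm_real, Real.norm_eq_abs, abs_of_nonneg (hw0 u hu)]
          calc w u * ‖q u - q₀‖ ≤ w u * (M * u) := mul_le_mul_of_nonneg_left (hq₀ u hu) (hw0 u hu)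
            _ = M * (u * w u) := by ring
      _ = M * ∫ u in Ioc 0 ℓ, u * w u := integral_const_mul _ _
      _ ≤ M * (Real.Gamma (2 - μ) * L ^ (μ - 2)) :=
          mul_le_mul_of_nonneg_left (setIntegral_Ioc_mul_rpowExpWeight_le hμ hL) hM
  · -- the tail part
    rw [norm_mul, Complex.norm_real, Real.norm_eq_abs,
      abs_of_nonneg (setIntegral_nonneg measurableSet_Ioi fun u hu ↦
        rpowExpWeight_nonneg μ L (hℓ.trans hu).le)]
    exact mul_le_mul_of_nonneg_left (setIntegral_Ioi_rpowExpWeight_le hμ hL hℓ) (norm_nonneg _)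

end Literature.Analysis.Asymptotics

end
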